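import Literature.NumberTheory.GelbartRogawski1991.Prop311AsPrintedCM
import HarnessLib

-- buildfix G11b-3 recipe (LEDGER B13-1/B13-3): elaborate sequentially (dependent telescopes of the CM dual-pair datum).
set_option Elab.async false

/-!
# [GelbartRogawski1991, Proposition 3.1.1] AS PRINTED — `Prop311AsPrinted` SPECIALISED TO `(F, E) = (L⁺, L)`, binder for binder

Topic `NumberTheory/GelbartRogawski1991`; namespace `Literature.NumberTheory.GelbartRogawski1991.Prop311`.  KERNEL ONLY:
theorems; no definition, no named fact, no `sorry`; `Prop311AsPrinted` itself is untouched (nothing of it is assumed).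

`Prop311AsPrintedCM.prop311AsPrinted_CM` proves the body of `Prop311AsPrinted` at CM data in the conventions of the GR lane
(`V` an `L`-space with its `L⁺`-structure by restriction, `σ` = `IsCMField.complexConj`).  This file closes the two remaining
cosmetic gaps to the LITERAL binder telescope of `Prop311AsPrinted` ([GelbartRogawski1991, §1.1 p. 449 L26–32, §3.1 p. 454
L17–42, Prop. 3.1.1 p. 455 L1–2] as rendered there) once `F := L⁺ = maximalRealSubfield L` and `E := L` (a CM field, with
its canonical `Field`/`Algebra`/`IsQuadraticExtension` structure) are fixed:
* `algEquiv_eq_complexConj`: "conjugation denoted by a bar" — ANY `σ : L ≃ₐ[L⁺] L` with `σ ≠ 1` (the printed binders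
  `(σ) (_hσ : σ ≠ 1)`) IS `IsCMField.complexConj L` (Mathlib: the conjugation generates `Gal(L/L⁺)`, of order `2`);
* `module_eq_of_isScalarTower`: ANY `L⁺`-module structure `P` on `V` compatible with the `L`-structure (the printed binders
  `[Module F V] [Module E V] [IsScalarTower F E V]` — "`W` coincides with `V`, but viewed as an `F`-vector space") IS the
  restricted one; at `F = L⁺ ⊆ L = E` Lean also carries the restricted `L⁺`-action, so the `IsScalarTower` binder is written
  with the scalar multiplication of `P` pinned explicitly (that is what the printed binder means);
* **`prop311AsPrinted_specialization_CM`**: the statement of `Prop311AsPrinted` with `F := ↥(maximalRealSubfield L)`, `E := L`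
  and EVERY LATER BINDER KEPT VERBATIM (`σ _hσ ψ _hψc _hψF _hψ1 n V [..] _hn Φ _hΦ₁ _hΦ₂ _hΦ₃ _hφ S [..] ρ _hρu _hρc _hρi _hρz i
  _hi _hi!`) — PROVED, for every CM field `L`.

Not covered (and not claimed): the quadratic extensions `E/F` of number fields that are not CM.  HC_CM is not touched.

## References
* [GelbartRogawski1991] S. Gelbart, J. Rogawski, Invent. Math. 105 (1991) 445–472, §1.1 p. 449 L26–32, §3.1 p. 454 L17–42,
  Prop. 3.1.1 p. 455 L1–2.
-/

set_option autoImplicit false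

noncomputable section

open NumberField
open scoped TensorProduct
open Literature.RepresentationTheory.HeisenbergGroup

namespace Literature.NumberTheory.GelbartRogawski1991

namespace Prop311

/-- "conjugation denoted by a bar": over a CM field `L`, the only non-trivial `L⁺`-algebra automorphism of `L` is the complex
conjugation. [cite: GelbartRogawski1991, §1.1 p. 449 L26] -/
theorem algEquiv_eq_complexConj (L : Type) [Field L] [NumberField L] [IsCMField L]
    (σ : L ≃ₐ[↥(maximalRealSubfield L)] L) (hσ : σ ≠ 1) : σ = IsCMField.complexConj L := by
  have hmem : σ ∈ Subgroup.zpowers (IsCMField.complexConj L) := by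
    rw [IsCMField.zpowers_complexConj_eq_top]
    exact Subgroup.mem_top σ
  obtain ⟨k, hk⟩ := Subgroup.mem_zpowers_iff.1 hmem
  have h2 : IsCMField.complexConj L ^ (2 : ℤ) = 1 := by
    rw [zpow_ofNat, ← IsCMField.orderOf_complexConj L, pow_orderOf_eq_one]
  obtain ⟨m, rfl⟩ | ⟨m, rfl⟩ := Int.even_or_odd k
  · exfalso
    apply hσ
    rw [← hk, ← two_mul, zpow_mul, h2, one_zpow]
  · rw [← hk, zpow_add, zpow_one, zpow_mul, h2, one_zpow, one_mul]

/-- "`W` coincides with `V`, but viewed as an `F`-vector space": an `L⁺`-module structure `P` on an `L`-space compatible with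
the `L`-structure (`IsScalarTower` for the scalar multiplication OF `P`) is the restriction of scalars.
[cite: GelbartRogawski1991, §3.1 p. 454 L41–42] -/
theorem module_eq_of_isScalarTower (L : Type) [Field L] (V : Type) [AddCommGroup V] [Module L V]
    (P : Module (↥(maximalRealSubfield L)) V)
    (hP : @IsScalarTower (↥(maximalRealSubfield L)) L V _ _
      (@SMulZeroClass.toSMul _ _ _ (@DistribSMul.toSMulZeroClass _ _ _
        (@DistribMulAction.toDistribSMul _ _ _ _ (@Module.toDistribMulAction _ _ _ _ P))))) :
    P = (Subfield.instModuleSubtypeMem (maximalRealSubfield L) : Module (↥(maximalRealSubfield L)) V) := by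
  refine Module.ext' _ _ fun r v => ?_
  -- `r •_P v = r •_P (1 • v) = (r • 1) • v = (↑r * 1) • v = ↑r • v`
  have h1 := @IsScalarTower.smul_assoc _ _ _ _ _ _ hP r (1 : L) v
  rw [one_smul] at h1
  rw [← h1]
  show ((r : L) * 1) • v = _
  rw [mul_one]
  rfl

/-- **[GelbartRogawski1991, Proposition 3.1.1] AS PRINTED: the statement `Prop311AsPrinted` with `F := L⁺`, `E := L` (`L` any CM
field) and every later binder verbatim — PROVED.**  "(1) The covering `π` splits over `G(𝐀)`. (2) There exists a continuous
section `s : G(𝐀) → Mp_𝐀(W)` such that `s(G(F))` is contained in `i(Sp_F(W))`."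
[cite: GelbartRogawski1991, §3.1 Proposition 3.1.1, p. 455 L1–2; §1.1 p. 449 L26–32; §3.1 p. 454 L17–42] -/
theorem prop311AsPrinted_specialization_CM (L : Type) [Field L] [NumberField L] [IsCMField L] :
    ∀ -- "E/F = quadratic extension of number fields, conjugation denoted by a bar" (p. 449 L26): here E/F = L/L⁺
      (σ : L ≃ₐ[↥(maximalRealSubfield L)] L) (_hσ : σ ≠ 1)
      -- "ψ will denote a non-trivial additive character of F\𝐀" (p. 449 L32; p. 454 L19–20)
      (ψ : AddChar (AdeleRing (𝓞 ↥(maximalRealSubfield L)) ↥(maximalRealSubfield L)) Circle) (_hψc : Continuous ψ)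
      (_hψF : ∀ x : ↥(maximalRealSubfield L),
        ψ (algebraMap (↥(maximalRealSubfield L)) (AdeleRing (𝓞 ↥(maximalRealSubfield L)) ↥(maximalRealSubfield L)) x) = 1)
      (_hψ1 : ψ ≠ 1)
      -- "(V, Φ) a skew Hermitian space, where V is an n-dimensional vector space over E" (p. 454 L37–38),
      -- "W coincides with V, but viewed as an F-vector space, and φ = Tr_{E/F}(Φ)" (p. 454 L41–42)
      (n : ℕ) (V : Type) [AddCommGroup V] [P : Module (↥(maximalRealSubfield L)) V] [Module L V]
      -- `[IsScalarTower F E V]` — for the scalar multiplication OF the binder `P` (at `F = L⁺ ⊆ L = E` Lean also knows the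
      -- restricted `L⁺`-action on `V`; the printed binder is about `P`, so the `SMul` is pinned to `P` explicitly)
      [_hP : @IsScalarTower (↥(maximalRealSubfield L)) L V _ _
        (@SMulZeroClass.toSMul _ _ _ (@DistribSMul.toSMulZeroClass _ _ _
        (@DistribMulAction.toDistribSMul _ _ _ _ (@Module.toDistribMulAction _ _ _ _ P))))]
      [FiniteDimensional L V] (_hn : Module.finrank L V = n)
      (Φ : V →ₗ[↥(maximalRealSubfield L)] V →ₗ[↥(maximalRealSubfield L)] L)
      (_hΦ₁ : ∀ (e : L) (x y : V), Φ (e • x) y = e * Φ x y)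
      (_hΦ₂ : ∀ (e : L) (x y : V), Φ x (e • y) = Φ x y * σ e)
      (_hΦ₃ : ∀ x y : V, Φ y x = -σ (Φ x y))
      -- "(W, φ) … symplectic space" (p. 454 L17, L40–41): φ non-degenerate
      (_hφ : (traceForm (↥(maximalRealSubfield L)) L V Φ).Nondegenerate)
      -- "ρ_ψ an irreducible unitary representation of H_𝐀(W) with central character ψ" (p. 454 L20–21)
      (S : Type) [NormedAddCommGroup S] [InnerProductSpace ℂ S] [CompleteSpace S]
      (ρ : Representation ℂ (AdelicHeisenberg (↥(maximalRealSubfield L)) L V Φ) S)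
      (_hρu : ∀ (h : AdelicHeisenberg (↥(maximalRealSubfield L)) L V Φ) (f : S), ‖ρ h f‖ = ‖f‖)
      (_hρc : ∀ f : S, @Continuous _ _ (heisenbergTopology (↥(maximalRealSubfield L)) L V Φ) _ fun h => ρ h f)
      (_hρi : ∀ K : Submodule ℂ S, IsClosed (K : Set S) →
        (∀ (h : AdelicHeisenberg (↥(maximalRealSubfield L)) L V Φ), ∀ f ∈ K, ρ h f ∈ K) → K = ⊥ ∨ K = ⊤)
      (_hρz : ∀ (t : AdeleRing (𝓞 ↥(maximalRealSubfield L)) ↥(maximalRealSubfield L)) (f : S),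
        ρ (Heisenberg.ofCenter (heisForm (↥(maximalRealSubfield L)) L V Φ) (Multiplicative.ofAdd t)) f =
          ((ψ t : Circle) : ℂ) • f)
      -- "π splits uniquely over … Sp_F(W). We denote this splitting by i." (p. 454 L35–36)
      (i : ratSp (↥(maximalRealSubfield L)) L V Φ →* adelicMp (↥(maximalRealSubfield L)) L V Φ ρ)
      (_hi : IsRationalSplitting (↥(maximalRealSubfield L)) L V Φ ρ i)
      (_hi! : ∀ i' : ratSp (↥(maximalRealSubfield L)) L V Φ →* adelicMp (↥(maximalRealSubfield L)) L V Φ ρ,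
        IsRationalSplitting (↥(maximalRealSubfield L)) L V Φ ρ i' → i' = i),
    -- "Proposition 3.1.1. The covering π splits over G(𝐀)." (p. 455 L1)
    (∃ s : adelicUnitary (↥(maximalRealSubfield L)) L V Φ →* adelicMp (↥(maximalRealSubfield L)) L V Φ ρ,
        ∀ g : adelicUnitary (↥(maximalRealSubfield L)) L V Φ,
          projEnd (↥(maximalRealSubfield L)) L V Φ ρ (s g) =
            ((g : AdelicSpace (↥(maximalRealSubfield L)) V ≃ₗ[AdeleRing (𝓞 ↥(maximalRealSubfield L)) ↥(maximalRealSubfield L)]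
                AdelicSpace (↥(maximalRealSubfield L)) V) :
              AdelicSpace (↥(maximalRealSubfield L)) V →ₗ[AdeleRing (𝓞 ↥(maximalRealSubfield L)) ↥(maximalRealSubfield L)]
                AdelicSpace (↥(maximalRealSubfield L)) V)) ∧
    -- "There exists a continuous section s : G(𝐀) → Mp_𝐀(W) such that s(G(F)) is contained in i(Sp_F(W))." (p. 455 L1–2)
      ∃ s : adelicUnitary (↥(maximalRealSubfield L)) L V Φ →* adelicMp (↥(maximalRealSubfield L)) L V Φ ρ,
        Continuous s ∧
        (∀ g : adelicUnitary (↥(maximalRealSubfield L)) L V Φ,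
          projEnd (↥(maximalRealSubfield L)) L V Φ ρ (s g) =
            ((g : AdelicSpace (↥(maximalRealSubfield L)) V ≃ₗ[AdeleRing (𝓞 ↥(maximalRealSubfield L)) ↥(maximalRealSubfield L)]
                AdelicSpace (↥(maximalRealSubfield L)) V) :
              AdelicSpace (↥(maximalRealSubfield L)) V →ₗ[AdeleRing (𝓞 ↥(maximalRealSubfield L)) ↥(maximalRealSubfield L)]
                AdelicSpace (↥(maximalRealSubfield L)) V)) ∧
        ∀ g : adelicUnitary (↥(maximalRealSubfield L)) L V Φ,
          IsRationalPoint (↥(maximalRealSubfield L)) L V Φ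
              (g : AdelicSpace (↥(maximalRealSubfield L)) V ≃ₗ[AdeleRing (𝓞 ↥(maximalRealSubfield L)) ↥(maximalRealSubfield L)]
                AdelicSpace (↥(maximalRealSubfield L)) V) →
            s g ∈ i.range := by
  intro σ hσ ψ hψc hψF hψ1 n V _ P _ hP _ hn Φ hΦ₁ hΦ₂ hΦ₃ hφ S _ _ _ ρ hρu hρc hρi hρz i hi _
  -- the conjugation is `complexConj`, the `L⁺`-structure is the restricted one
  have hσ' : σ = IsCMField.complexConj L := algEquiv_eq_complexConj L σ hσ
  subst hσ'
  have hP' : P = (Subfield.instModuleSubtypeMem (maximalRealSubfield L) : Module (↥(maximalRealSubfield L)) V) :=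
    module_eq_of_isScalarTower L V P hP
  subst hP'
  exact prop311AsPrinted_CM L ψ hψc hψF hψ1 V Φ hΦ₁ hΦ₂ hΦ₃ hφ S ρ hρu hρc hρi hρz i hi

end Prop311

end Literature.NumberTheory.GelbartRogawski1991

end
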